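import Literature.Analysis.FluidPDE.TaoAveragedComplexAverageReal
import Literature.Analysis.FluidPDE.TaoCascadeDuhamel

/-!
# Route PerpetualPump · `EulerTypeIGlue` — toolkit V: the Duhamel integrand of Tao's mild
# formulation is continuous in time

Support file for the support item `EulerTypeIGlue` (stmt-NavierStokesRegularity-1838). For an
`H¹⁰`-continuous, `H¹⁰`-bounded curve `v` and any `w ∈ L²(ℝ³; ℂ³)`, the Duhamel integrand of
Tao's mild formulation (1.15), `s ↦ ⟨B(v(s), v(s)), e^{(t-s)Δ} w⟩`, is continuous (hence
interval integrable), because the Euler form is bounded and trilinear on `H¹⁰ × H¹⁰ × L²`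
(`enorm_eulerForm_le`, `eulerForm_add_smulᵢ`) and the heat propagator is strongly continuous on
`L²` (`continuous_heat_apply`, dominated convergence on the Fourier side). Also: the heat
propagator is symmetric for the bilinear pairing (tree: `Tao2016.pairing_heat_left`).

## References

* T. Tao, J. Amer. Math. Soc. 29 (2016), arXiv:1402.0290v3, §1.1 (1.3), (1.5), (1.15), p. 7
  (absolute convergence of the forms). [Tao2016AveragedNS]
-/

noncomputable section

open MeasureTheory Set Filter Topology FourierTransform
open scoped ENNReal NNReal FourierTransform

set_option linter.dupNamespace false

namespace Summit.NavierStokesRegularity.NavierStokesRegularity.Theorems.PerpetualPumpEulerTypeIGlue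

open Literature.Analysis.FluidPDE Literature.Analysis.FluidPDE.Tao2016
open Literature.Analysis.FunctionSpaces (eFourierSobolevNorm)

/-- Local notation for physical / frequency space `ℝ³`. -/
local notation "ℝ³" => EuclideanSpace ℝ (Fin 3)
/-- Local notation for the complexified range `ℂ³`. -/
local notation "ℂ³" => EuclideanSpace ℂ (Fin 3)

/-! ### Strong continuity of the heat propagator on `L²` -/

/-- The difference of two heat propagators is the Fourier multiplier with the difference of the
symbols (a.e. on the Fourier side). [folklore] -/
theorem fourierFn_heat_sub_heat (τ τ₀ : ℝ) (w : L2C) :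
    fourierFn (heat τ w - heat τ₀ w) =ᵐ[volume]
      fun ξ => (heatSymbol τ ξ - heatSymbol τ₀ ξ) • fourierFn w ξ := by
  have hsub : fourierFn (heat τ w - heat τ₀ w) =ᵐ[volume] fourierFn (heat τ w) - fourierFn (heat τ₀ w) := by
    unfold fourierFn
    have h : (𝓕 (heat τ w - heat τ₀ w) : L2C) = (𝓕 (heat τ w) : L2C) - 𝓕 (heat τ₀ w) :=
      (Lp.fourierTransformₗᵢ ℝ³ ℂ³).map_sub (heat τ w) (heat τ₀ w)
    rw [h]
    exact Lp.coeFn_sub _ _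
  filter_upwards [hsub, fourierFn_heat τ w, fourierFn_heat τ₀ w] with ξ h h1 h2
  rw [h, Pi.sub_apply, h1, h2, sub_smul]

/-- `‖u‖² = ∫ ‖û‖²` (Plancherel) in `ℝ≥0∞`. [folklore] -/
theorem enorm_sq_eq_lintegral_fourierFn (u : L2C) : ‖u‖ₑ ^ 2 = ∫⁻ ξ, ‖fourierFn u ξ‖ₑ ^ 2 := by
  rw [← lintegral_enorm_sq_fourierFn_rpow_eq, ← ENNReal.rpow_natCast, ← ENNReal.rpow_mul]
  norm_num

/-- **Strong continuity of `τ ↦ e^{τΔ}w` on `L²(ℝ³; ℂ³)`** (dominated convergence on the Fourier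
side: `|e^{-4π²τ|ξ|²} - e^{-4π²τ₀|ξ|²}|² |ŵ|² ≤ 4|ŵ|²`). [folklore] -/
theorem continuous_heat_apply (w : L2C) : Continuous fun τ : ℝ => heat τ w := by
  refine continuous_iff_continuousAt.2 fun τ₀ => ?_
  rw [ContinuousAt, tendsto_iff_norm_sub_tendsto_zero]
  -- the squared norm as a Fourier-side integral
  have hsq : ∀ τ, ‖heat τ w - heat τ₀ w‖ₑ ^ 2 =
      ∫⁻ ξ, ‖heatSymbol τ ξ - heatSymbol τ₀ ξ‖ₑ ^ 2 * ‖fourierFn w ξ‖ₑ ^ 2 := by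
    intro τ
    rw [enorm_sq_eq_lintegral_fourierFn]
    refine lintegral_congr_ae ?_
    filter_upwards [fourierFn_heat_sub_heat τ τ₀ w] with ξ hξ
    rw [hξ, enorm_smul, mul_pow]
  -- dominated convergence
  have hlim : Tendsto (fun τ => ∫⁻ ξ, ‖heatSymbol τ ξ - heatSymbol τ₀ ξ‖ₑ ^ 2 * ‖fourierFn w ξ‖ₑ ^ 2)
      (𝓝 τ₀) (𝓝 0) := by
    have hmeas : ∀ τ, AEMeasurable
        (fun ξ => ‖heatSymbol τ ξ - heatSymbol τ₀ ξ‖ₑ ^ 2 * ‖fourierFn w ξ‖ₑ ^ 2) volume := fun τ =>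
      ((((continuous_heatSymbol τ).sub (continuous_heatSymbol τ₀)).aestronglyMeasurable.enorm.pow_const 2)).mul
        ((aestronglyMeasurable_fourierFn w).enorm.pow_const 2)
    have hfin : ∫⁻ ξ, 4 * ‖fourierFn w ξ‖ₑ ^ 2 ≠ ⊤ := by
      rw [lintegral_const_mul'' _ ((aestronglyMeasurable_fourierFn w).enorm.pow_const 2),
        ← enorm_sq_eq_lintegral_fourierFn]
      exact ENNReal.mul_ne_top (by norm_num) (ENNReal.pow_ne_top enorm_ne_top)
    have h0 : (0 : ℝ≥0∞) = ∫⁻ _ξ : ℝ³, 0 := lintegral_zero.symm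
    rw [h0]
    refine tendsto_lintegral_filter_of_dominated_convergence' (fun ξ => 4 * ‖fourierFn w ξ‖ₑ ^ 2)
      (Eventually.of_forall hmeas) (Eventually.of_forall fun τ => Eventually.of_forall fun ξ => ?_) hfin
      (Eventually.of_forall fun ξ => ?_)
    · -- domination
      refine mul_le_mul' ?_ le_rfl
      have h1 : ‖heatSymbol τ ξ - heatSymbol τ₀ ξ‖ₑ ≤ 2 := by
        refine (enorm_sub_le).trans ?_
        calc ‖heatSymbol τ ξ‖ₑ + ‖heatSymbol τ₀ ξ‖ₑ ≤ 1 + 1 := add_le_add (enorm_heatSymbol_le τ ξ) (enorm_heatSymbol_le τ₀ ξ)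
          _ = 2 := by norm_num
      calc ‖heatSymbol τ ξ - heatSymbol τ₀ ξ‖ₑ ^ 2 ≤ 2 ^ 2 := by gcongr
        _ = 4 := by norm_num
    · -- pointwise convergence
      have hc : Continuous fun τ : ℝ => heatSymbol τ ξ :=
        continuous_heatSymbol₂.comp (continuous_id.prodMk continuous_const)
      have ht : Tendsto (fun τ => ‖heatSymbol τ ξ - heatSymbol τ₀ ξ‖ₑ ^ 2 * ‖fourierFn w ξ‖ₑ ^ 2) (𝓝 τ₀)
          (𝓝 (‖heatSymbol τ₀ ξ - heatSymbol τ₀ ξ‖ₑ ^ 2 * ‖fourierFn w ξ‖ₑ ^ 2)) := by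
        refine ENNReal.Tendsto.mul_const (ENNReal.Tendsto.pow ?_) (Or.inr (ENNReal.pow_ne_top enorm_ne_top))
        exact (continuous_enorm.comp (hc.sub continuous_const)).continuousAt.tendsto
      simpa using ht
  -- back to the norm
  have hlim' : Tendsto (fun τ => ‖heat τ w - heat τ₀ w‖ₑ) (𝓝 τ₀) (𝓝 0) := by
    have h2 : Tendsto (fun τ => (‖heat τ w - heat τ₀ w‖ₑ ^ 2) ^ (1 / 2 : ℝ)) (𝓝 τ₀) (𝓝 (0 ^ (1 / 2 : ℝ))) := by
      simp_rw [hsq]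
      exact (ENNReal.continuous_rpow_const.tendsto 0).comp hlim
    rw [ENNReal.zero_rpow_of_pos (by norm_num)] at h2
    refine h2.congr fun τ => ?_
    rw [← ENNReal.rpow_natCast, ← ENNReal.rpow_mul]
    norm_num
  have h3 := (ENNReal.tendsto_toReal ENNReal.zero_ne_top).comp hlim'
  rw [ENNReal.toReal_zero] at h3
  refine h3.congr fun τ => ?_
  rw [Function.comp_apply, toReal_enorm]

/-! ### The Euler form: real-valued bound and differences -/

/-- The constant `K = (∫ (1+|ξ|²)^{-10})^{1/2}` of `H¹⁰ ⊂ 𝓕L¹`, as a real number. [folklore] -/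
theorem sobolevTen_const_lt_top :
    (∫⁻ ξ : ℝ³, ENNReal.ofReal ((1 + ‖ξ‖ ^ 2) ^ (-10 : ℝ))) ^ (1 / 2 : ℝ) < ⊤ :=
  ENNReal.rpow_lt_top_of_nonneg (by norm_num) lintegral_inv_sobolevWeight_lt_top.ne

/-- **Real-valued bound for the Euler form on `H¹⁰ × H¹⁰ × L²`**:
`|⟨B(u,v), w⟩| ≤ 2πK ‖u‖_{H¹⁰} ‖v‖_{H¹⁰} ‖w‖`. [cite: Tao2016AveragedNS, §1.1 (1.3) p. 3] -/
theorem norm_eulerForm_le {u v : L2C} (w : L2C) (hu : eFourierSobolevNorm 10 u < ⊤)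
    (hv : eFourierSobolevNorm 10 v < ⊤) :
    ‖eulerForm u v w‖ ≤ (Real.pi * (2 * ((∫⁻ ξ : ℝ³, ENNReal.ofReal ((1 + ‖ξ‖ ^ 2) ^ (-10 : ℝ))) ^
      (1 / 2 : ℝ)).toReal)) * (eFourierSobolevNorm 10 u).toReal * (eFourierSobolevNorm 10 v).toReal * ‖w‖ := by
  have h := enorm_eulerForm_le u v w
  have hK := sobolevTen_const_lt_top
  have hfin : ENNReal.ofReal Real.pi * (2 * (∫⁻ ξ : ℝ³, ENNReal.ofReal ((1 + ‖ξ‖ ^ 2) ^ (-10 : ℝ))) ^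
      (1 / 2 : ℝ) * eFourierSobolevNorm 10 u * eFourierSobolevNorm 10 v * ‖w‖ₑ) ≠ ⊤ := by
    refine ENNReal.mul_ne_top ENNReal.ofReal_ne_top ?_
    exact ENNReal.mul_ne_top (ENNReal.mul_ne_top (ENNReal.mul_ne_top
      (ENNReal.mul_ne_top (by norm_num) hK.ne) hu.ne) hv.ne) enorm_ne_top
  have h' := ENNReal.toReal_mono hfin h
  rw [toReal_enorm] at h'
  refine h'.trans (le_of_eq ?_)
  rw [ENNReal.toReal_mul, ENNReal.toReal_ofReal Real.pi_pos.le, ENNReal.toReal_mul, ENNReal.toReal_mul,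
    ENNReal.toReal_mul, ENNReal.toReal_mul, toReal_enorm]
  norm_num
  ring

/-- `⟨B(u,v), z⟩ - ⟨B(u,v), z'⟩ = ⟨B(u,v), z - z'⟩` on `H¹⁰`. [cite: Tao2016AveragedNS, §1.1 (1.3)] -/
theorem eulerForm_sub₃ {u v : L2C} (z z' : L2C) (hu : eFourierSobolevNorm 10 u < ⊤)
    (hv : eFourierSobolevNorm 10 v < ⊤) :
    eulerForm u v z - eulerForm u v z' = eulerForm u v (z - z') := by
  have h := eulerForm_add_smul₃ (-1) z z' hu hv
  rw [neg_one_smul, ← sub_eq_add_neg] at h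
  rw [h]
  ring

/-- `H¹⁰` norms of differences are finite. [folklore] -/
theorem eFourierSobolevNorm_sub_lt_top {x x' : L2C} (hx : eFourierSobolevNorm 10 x < ⊤)
    (hx' : eFourierSobolevNorm 10 x' < ⊤) : eFourierSobolevNorm 10 (x - x') < ⊤ := by
  have h1 : eFourierSobolevNorm 10 (x - x') ≤ eFourierSobolevNorm 10 x + eFourierSobolevNorm 10 x' := by
    have h := eFourierSobolevNorm_add_le 10 x (-x')
    rwa [eFourierSobolevNorm_neg, ← sub_eq_add_neg] at h
  exact lt_of_le_of_lt h1 (ENNReal.add_lt_top.2 ⟨hx, hx'⟩)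

/-- `⟨B(x,v), z⟩ - ⟨B(x',v), z⟩ = ⟨B(x - x',v), z⟩` on `H¹⁰`. [cite: Tao2016AveragedNS, §1.1 (1.3)] -/
theorem eulerForm_sub₁ {x x' v : L2C} (z : L2C) (hx : eFourierSobolevNorm 10 x < ⊤)
    (hx' : eFourierSobolevNorm 10 x' < ⊤) (hv : eFourierSobolevNorm 10 v < ⊤) :
    eulerForm x v z - eulerForm x' v z = eulerForm (x - x') v z := by
  have hxx' : eFourierSobolevNorm 10 (x - x') < ⊤ := eFourierSobolevNorm_sub_lt_top hx hx'
  have h := eulerForm_add_smul₁ 1 z hxx' hx' hv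
  rw [one_smul, sub_add_cancel, one_mul] at h
  rw [h]
  ring

/-- `⟨B(u,y), z⟩ - ⟨B(u,y'), z⟩ = ⟨B(u,y - y'), z⟩` on `H¹⁰`. [cite: Tao2016AveragedNS, §1.1 (1.3)] -/
theorem eulerForm_sub₂ {u y y' : L2C} (z : L2C) (hu : eFourierSobolevNorm 10 u < ⊤)
    (hy : eFourierSobolevNorm 10 y < ⊤) (hy' : eFourierSobolevNorm 10 y' < ⊤) :
    eulerForm u y z - eulerForm u y' z = eulerForm u (y - y') z := by
  rw [eulerForm_symm u y, eulerForm_symm u y', eulerForm_symm u (y - y')]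
  exact eulerForm_sub₁ z hy hy' hu

/-- The heat propagator is a contraction of `L²`. [folklore] -/
theorem norm_heat_le (τ : ℝ) (w : L2C) : ‖heat τ w‖ ≤ ‖w‖ := by
  have h := eFourierSobolevNorm_heat_le 0 τ w
  rw [Literature.Analysis.FunctionSpaces.eFourierSobolevNorm_zero_eq_enorm,
    Literature.Analysis.FunctionSpaces.eFourierSobolevNorm_zero_eq_enorm, ← ofReal_norm, ← ofReal_norm] at h
  exact (ENNReal.ofReal_le_ofReal_iff (norm_nonneg _)).1 h

/-! ### Continuity of the Duhamel integrand -/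

/-- **The Duhamel integrand `s ↦ ⟨B(v(s), v(s)), e^{(t-s)Δ} w⟩` is continuous** on a time
interval on which `v` is `H¹⁰`-continuous with `H¹⁰` norms bounded by `M` (Tao 2016, p. 7: the
forms converge absolutely for `H¹⁰` arguments; with the strong continuity of `e^{τΔ}` on `L²`). [cite: Tao2016AveragedNS, §1.1 (1.15) p. 7] -/
theorem continuousOn_eulerForm_heat {I : Set ℝ} {v : ℝ → L2C} (hv : ContinuousInH10On I v)
    {M : ℝ} (hM : ∀ s ∈ I, eFourierSobolevNorm 10 (v s) ≤ ENNReal.ofReal M) (w : L2C) (t : ℝ) :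
    ContinuousOn (fun s => eulerForm (v s) (v s) (heat (t - s) w)) I := by
  set K : ℝ := Real.pi * (2 * ((∫⁻ ξ : ℝ³, ENNReal.ofReal ((1 + ‖ξ‖ ^ 2) ^ (-10 : ℝ))) ^
      (1 / 2 : ℝ)).toReal) with hK
  have hK0 : 0 ≤ K := by positivity
  have hM0 : ∀ s ∈ I, 0 ≤ M ∨ eFourierSobolevNorm 10 (v s) = 0 := fun s hs => by
    by_cases h : 0 ≤ M
    · exact Or.inl h
    · right
      have := hM s hs
      rw [ENNReal.ofReal_of_nonpos (not_le.1 h).le] at this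
      exact le_antisymm this zero_le
  have hfin : ∀ s ∈ I, eFourierSobolevNorm 10 (v s) < ⊤ := fun s hs =>
    lt_of_le_of_lt (hM s hs) ENNReal.ofReal_lt_top
  have hreal : ∀ s ∈ I, (eFourierSobolevNorm 10 (v s)).toReal ≤ max M 0 := fun s hs => by
    have := ENNReal.toReal_mono ENNReal.ofReal_ne_top (hM s hs)
    refine this.trans ?_
    by_cases h : 0 ≤ M
    · rw [ENNReal.toReal_ofReal h]; exact le_max_left _ _
    · rw [ENNReal.ofReal_of_nonpos (not_le.1 h).le, ENNReal.toReal_zero]; exact le_max_right _ _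
  intro s₀ hs₀
  rw [ContinuousWithinAt, tendsto_iff_norm_sub_tendsto_zero]
  set M' : ℝ := max M 0 with hM'
  have hM'0 : 0 ≤ M' := le_max_right _ _
  -- the three-term decomposition and its bound
  have hbound : ∀ s ∈ I, ‖eulerForm (v s) (v s) (heat (t - s) w) - eulerForm (v s₀) (v s₀) (heat (t - s₀) w)‖ ≤
      K * (eFourierSobolevNorm 10 (v s - v s₀)).toReal * M' * ‖w‖ +
      K * M' * (eFourierSobolevNorm 10 (v s - v s₀)).toReal * ‖w‖ +
      K * M' * M' * ‖heat (t - s) w - heat (t - s₀) w‖ := by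
    intro s hs
    have e1 := eulerForm_sub₁ (heat (t - s) w) (hfin s hs) (hfin s₀ hs₀) (hfin s hs)
    have e2 := eulerForm_sub₂ (heat (t - s) w) (hfin s₀ hs₀) (hfin s hs) (hfin s₀ hs₀)
    have e3 := eulerForm_sub₃ (heat (t - s) w) (heat (t - s₀) w) (hfin s₀ hs₀) (hfin s₀ hs₀)
    have hdec : eulerForm (v s) (v s) (heat (t - s) w) - eulerForm (v s₀) (v s₀) (heat (t - s₀) w) =
        eulerForm (v s - v s₀) (v s) (heat (t - s) w) + eulerForm (v s₀) (v s - v s₀) (heat (t - s) w) +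
          eulerForm (v s₀) (v s₀) (heat (t - s) w - heat (t - s₀) w) := by
      rw [← e1, ← e2, ← e3]; ring
    rw [hdec]
    have hsub := eFourierSobolevNorm_sub_lt_top (hfin s hs) (hfin s₀ hs₀)
    refine (norm_add₃_le).trans (add_le_add_three ?_ ?_ ?_)
    · refine (norm_eulerForm_le _ hsub (hfin s hs)).trans ?_
      have h1 := hreal s hs
      have h2 := norm_heat_le (t - s) w
      gcongr
    · refine (norm_eulerForm_le _ (hfin s₀ hs₀) hsub).trans ?_
      have h1 := hreal s₀ hs₀
      have h2 := norm_heat_le (t - s) w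
      gcongr
    · refine (norm_eulerForm_le _ (hfin s₀ hs₀) (hfin s₀ hs₀)).trans ?_
      have h1 := hreal s₀ hs₀
      gcongr
  -- the two vanishing quantities
  have hH10 : Tendsto (fun s => (eFourierSobolevNorm 10 (v s - v s₀)).toReal) (𝓝[I] s₀) (𝓝 0) := by
    have h := (ENNReal.tendsto_toReal ENNReal.zero_ne_top).comp (hv s₀ hs₀)
    rw [ENNReal.toReal_zero] at h
    exact h.congr fun s => rfl
  have hheat : Tendsto (fun s => ‖heat (t - s) w - heat (t - s₀) w‖) (𝓝[I] s₀) (𝓝 0) := by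
    have hc : Continuous fun s : ℝ => heat (t - s) w :=
      (continuous_heat_apply w).comp (continuous_const.sub continuous_id)
    have := ((hc.tendsto s₀).sub_const (heat (t - s₀) w)).norm
    simp only [sub_self, norm_zero] at this
    exact this.mono_left nhdsWithin_le_nhds
  have hrhs : Tendsto (fun s => K * (eFourierSobolevNorm 10 (v s - v s₀)).toReal * M' * ‖w‖ +
      K * M' * (eFourierSobolevNorm 10 (v s - v s₀)).toReal * ‖w‖ +
      K * M' * M' * ‖heat (t - s) w - heat (t - s₀) w‖) (𝓝[I] s₀) (𝓝 0) := by
    have h1 : Tendsto (fun s => K * (eFourierSobolevNorm 10 (v s - v s₀)).toReal * M' * ‖w‖) (𝓝[I] s₀)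
        (𝓝 (K * 0 * M' * ‖w‖)) := ((hH10.const_mul K).mul_const M').mul_const ‖w‖
    have h2 : Tendsto (fun s => K * M' * (eFourierSobolevNorm 10 (v s - v s₀)).toReal * ‖w‖) (𝓝[I] s₀)
        (𝓝 (K * M' * 0 * ‖w‖)) := (hH10.const_mul (K * M')).mul_const ‖w‖
    have h3 : Tendsto (fun s => K * M' * M' * ‖heat (t - s) w - heat (t - s₀) w‖) (𝓝[I] s₀)
        (𝓝 (K * M' * M' * 0)) := hheat.const_mul (K * M' * M')
    simpa using (h1.add h2).add h3
  refine squeeze_zero_norm' ?_ hrhs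
  filter_upwards [self_mem_nhdsWithin] with s hs
  rw [norm_norm]
  exact hbound s hs

/-- Consequently the Duhamel integrand is interval integrable on `[0, t] ⊆ I`. [folklore] -/
theorem intervalIntegrable_eulerForm_heat {I : Set ℝ} {v : ℝ → L2C} (hv : ContinuousInH10On I v)
    {M : ℝ} (hM : ∀ s ∈ I, eFourierSobolevNorm 10 (v s) ≤ ENNReal.ofReal M) (w : L2C) {t t' : ℝ}
    (ht : uIcc 0 t ⊆ I) :
    IntervalIntegrable (fun s => eulerForm (v s) (v s) (heat (t' - s) w)) volume 0 t :=
  ((continuousOn_eulerForm_heat hv hM w t').mono ht).intervalIntegrable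

end Summit.NavierStokesRegularity.NavierStokesRegularity.Theorems.PerpetualPumpEulerTypeIGlue

end
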